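import Summits.MatrixMultiplication.OmegaCensus.SmallFormats.KroneckerBlocks

/-!
# Kronecker modules VI-b: the regular part — cyclic decomposition, `N` blocks and companion blocks

Cell `pub-omega` (unit `pub-omega-tensor-g33`), topic `Summits/MatrixMultiplication/OmegaCensus` (sub-folder `SmallFormats`).
Framing (verbatim): lottery ticket; floor = certified bounds/negative ranges. HONEST FRAMING: general linear algebra toward
PROVING `KroneckerBlockForm97`; nothing on `ω` here.

From Mathlib's structure theorem for finitely generated torsion modules over a PID (`Module.equiv_directSum_of_isTorsion`)
applied to the `k[X]`-module `Module.AEval' g` of an endomorphism `g`, we extract a *cyclic decomposition in coordinates*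
(`cyclic_decomposition`): vectors `w i j` (`j < D i`) spanning `W`, `Σ D i = finrank W`, with `g (w i j) = w i (j+1)` and
`g (w i (D i - 1)) = -Σ_m c i m • w i m` (companion relations, `c i` = coefficients of a monic polynomial of degree
`D i`); if `g` is nilpotent all `c i m = 0`. Consequences for a Kronecker module `(a, b)`: if `a` is bijective and
`a⁻¹ b` nilpotent, an `N`-block decomposition (`nilpotent_blockDecomposition`, power bases); if `b` is bijective, a
companion-block decomposition in the `PBlock` convention (`companion_blockDecomposition`, HORNER bases
`η_j = Σ_{m>j} c_m w_{m-1-j}`, which turn the power-basis relations into "subdiagonal ones + last column").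
-/

namespace Summit.MatrixMultiplication.OmegaCensus.SmallFormats.Kronecker

open Module Submodule
open scoped Polynomial

variable {k : Type*} [Field k]

/-! ## A `k`-basis of `k[X] ⧸ (r)` -/

section Quotient

variable (r : k[X])

/-- Every element of `k[X] ⧸ (r)` (`r ≠ 0`) is a combination of the classes of `X^j`, `j < natDegree r`. -/
theorem quot_span (hr : r ≠ 0) (y : k[X] ⧸ (k[X] ∙ r)) :
    ∃ d : ℕ → k, y = ∑ j ∈ Finset.range r.natDegree, d j • Submodule.Quotient.mk (Polynomial.X ^ j) := by
  induction y using Submodule.Quotient.induction_on with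
  | H f =>
    have hdiv : Submodule.Quotient.mk (p := k[X] ∙ r) f = Submodule.Quotient.mk (f % r) := by
      rw [Submodule.Quotient.eq, Submodule.mem_span_singleton]
      refine ⟨f / r, ?_⟩
      have := EuclideanDomain.div_add_mod f r
      rw [smul_eq_mul, mul_comm]
      linear_combination this
    by_cases h0 : f % r = 0
    · refine ⟨fun _ => 0, ?_⟩
      rw [hdiv, h0]; simp
    · have hdeg : (f % r).natDegree < r.natDegree :=
        Polynomial.natDegree_lt_natDegree h0 (EuclideanDomain.mod_lt f hr)
      refine ⟨fun j => (f % r).coeff j, ?_⟩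
      rw [hdiv]
      conv_lhs => rw [(f % r).as_sum_range_C_mul_X_pow' hdeg]
      rw [← Submodule.mkQ_apply, map_sum]
      refine Finset.sum_congr rfl (fun j _ => ?_)
      rw [Submodule.mkQ_apply, ← Polynomial.smul_eq_C_mul, Submodule.Quotient.mk_smul]

/-- The classes of `X^j`, `j < natDegree r`, are linearly independent in `k[X] ⧸ (r)`. -/
theorem quot_indep (hr : r ≠ 0) : LinearIndependent k (fun j : Fin r.natDegree =>
    Submodule.Quotient.mk (p := k[X] ∙ r) (Polynomial.X ^ (j : ℕ))) := by
  rw [Fintype.linearIndependent_iff]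
  intro d hd
  have hmk : Submodule.Quotient.mk (p := k[X] ∙ r) (∑ j : Fin r.natDegree, Polynomial.C (d j) * Polynomial.X ^ (j : ℕ)) = 0 := by
    rw [← Submodule.mkQ_apply, map_sum, ← hd]
    refine Finset.sum_congr rfl (fun j _ => ?_)
    rw [Submodule.mkQ_apply, ← Polynomial.smul_eq_C_mul, Submodule.Quotient.mk_smul]
  rw [Submodule.Quotient.mk_eq_zero, Submodule.mem_span_singleton] at hmk
  obtain ⟨c, hc⟩ := hmk
  have hdvd : r ∣ ∑ j : Fin r.natDegree, Polynomial.C (d j) * Polynomial.X ^ (j : ℕ) := ⟨c, by rw [← hc, smul_eq_mul, mul_comm]⟩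
  have hzero := Polynomial.eq_zero_of_dvd_of_degree_lt hdvd
    (lt_of_lt_of_le (Polynomial.degree_sum_fin_lt _) (Polynomial.degree_eq_natDegree hr).ge)
  intro j
  have := congrArg (fun p : k[X] => p.coeff j) hzero
  simp only [Polynomial.finsetSum_coeff, Polynomial.coeff_C_mul_X_pow, Polynomial.coeff_zero] at this
  rw [Finset.sum_eq_single j] at this
  · simpa using this
  · intro i _ hij; rw [if_neg (fun h => hij (Fin.ext h.symm))]
  · simp

/-- The power basis of `k[X] ⧸ (r)` indexed by `Fin (natDegree r)`. -/
noncomputable def quotBasis (hr : r ≠ 0) : Basis (Fin r.natDegree) k (k[X] ⧸ (k[X] ∙ r)) :=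
  Basis.mk (quot_indep r hr) (by
    rintro y -
    obtain ⟨d, rfl⟩ := quot_span r hr y
    refine Submodule.sum_mem _ (fun j hj => Submodule.smul_mem _ _ (Submodule.subset_span ?_))
    exact ⟨⟨j, Finset.mem_range.mp hj⟩, rfl⟩)

/-- Dimension of `k[X] ⧸ (r)`. -/
theorem finrank_quot (hr : r ≠ 0) : finrank k (k[X] ⧸ (k[X] ∙ r)) = r.natDegree := by
  rw [finrank_eq_card_basis (quotBasis r hr), Fintype.card_fin]

/-- The top relation: `X^D ≡ -Σ_{m<D} (lc⁻¹ coeff m) X^m` in `k[X] ⧸ (r)`. -/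
theorem quot_top (hr : r ≠ 0) :
    Submodule.Quotient.mk (p := k[X] ∙ r) (Polynomial.X ^ r.natDegree) =
      -∑ m ∈ Finset.range r.natDegree, (r.leadingCoeff⁻¹ * r.coeff m) • Submodule.Quotient.mk (Polynomial.X ^ m) := by
  have hlc : r.leadingCoeff ≠ 0 := Polynomial.leadingCoeff_ne_zero.mpr hr
  have hsum := r.as_sum_range_C_mul_X_pow
  rw [Finset.sum_range_succ, Polynomial.coeff_natDegree] at hsum
  set lc := r.leadingCoeff with hlcdef
  set D := r.natDegree with hDdef
  -- lc⁻¹ • r = Σ (lc⁻¹ coeff m) • X^m + X^D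
  have h2 : lc⁻¹ • r = (∑ m ∈ Finset.range D, (lc⁻¹ * r.coeff m) • Polynomial.X ^ m) + Polynomial.X ^ D := by
    conv_lhs => rw [hsum]
    rw [smul_add, Finset.smul_sum]
    congr 1
    · refine Finset.sum_congr rfl (fun m _ => ?_)
      rw [Polynomial.smul_eq_C_mul, Polynomial.smul_eq_C_mul, ← mul_assoc, ← Polynomial.C_mul]
    · rw [Polynomial.smul_eq_C_mul, ← mul_assoc, ← Polynomial.C_mul, inv_mul_cancel₀ hlc, Polynomial.C_1, one_mul]
  have hX : Polynomial.X ^ D = lc⁻¹ • r - ∑ m ∈ Finset.range D, (lc⁻¹ * r.coeff m) • Polynomial.X ^ m := by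
    rw [h2]; abel
  rw [hX, Submodule.Quotient.mk_sub, Submodule.Quotient.mk_smul,
    (Submodule.Quotient.mk_eq_zero _).mpr (Submodule.mem_span_singleton_self r), smul_zero, zero_sub,
    ← Submodule.mkQ_apply, map_sum]
  simp_rw [Submodule.mkQ_apply, Submodule.Quotient.mk_smul]

/-- In the nilpotent case (`r ∣ X^N`) all lower coefficients of `r` vanish. -/
theorem coeff_eq_zero_of_dvd_X_pow {N : ℕ} (hdvd : r ∣ Polynomial.X ^ N) : ∀ m < r.natDegree, r.coeff m = 0 := by
  obtain ⟨i, -, hassoc⟩ := (dvd_prime_pow (Polynomial.prime_X (R := k)) N).mp hdvd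
  obtain ⟨u, hu⟩ := hassoc.symm
  obtain ⟨c, hc, hcu⟩ := Polynomial.isUnit_iff.mp u.isUnit
  intro m hm
  rw [← hu, ← hcu, Polynomial.coeff_mul_C, Polynomial.coeff_X_pow]
  have hdeg : r.natDegree = i := by
    rw [← hu, ← hcu, Polynomial.natDegree_mul_C hc.ne_zero, Polynomial.natDegree_X_pow]
  rw [if_neg (by omega), zero_mul]

end Quotient

/-! ## Cyclic decomposition of an endomorphism in coordinates -/

section Cyclic

variable {W : Type*} [AddCommGroup W] [Module k W] [FiniteDimensional k W]

/-- **Cyclic decomposition in coordinates.** For an endomorphism `g` of a finite-dimensional space there are vectors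
`w i j` (`i < n`, `j < D i`, `Σ D i = finrank W`) spanning `W` with `g (w i j) = w i (j+1)` and
`g (w i (D i - 1)) = -Σ_{m < D i} c i m • w i m`; if `g` is nilpotent, all `c i m = 0` (`m < D i`).
(Summands with `D i = 0` may occur; they carry no vectors.) -/
theorem cyclic_decomposition (g : W →ₗ[k] W) :
    ∃ (n : ℕ) (D : Fin n → ℕ) (c : Fin n → ℕ → k) (w : Fin n → ℕ → W),
      (∑ i, D i = finrank k W) ∧
      (∀ x : W, ∃ d : Fin n → ℕ → k, x = ∑ i, ∑ j ∈ Finset.range (D i), d i j • w i j) ∧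
      (∀ i j, g (w i j) = w i (j + 1)) ∧
      (∀ i, g (w i (D i - 1)) = -∑ m ∈ Finset.range (D i), c i m • w i m) ∧
      (IsNilpotent g → ∀ i, ∀ m < D i, c i m = 0) := by
  classical
  -- the k[X]-module structure and the structure theorem
  let M := Module.AEval' g
  have hM : Module.IsTorsion k[X] M := Module.AEval.isTorsion_of_finiteDimensional k W g
  obtain ⟨ι, hι, p, hp, e, ⟨φ⟩⟩ := Module.equiv_directSum_of_isTorsion hM
  let r : ι → k[X] := fun i => p i ^ e i
  have hr : ∀ i, r i ≠ 0 := fun i => pow_ne_zero _ (hp i).ne_zero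
  let Q : ι → Type _ := fun i => k[X] ⧸ (k[X] ∙ r i)
  let of := Module.AEval'.of g
  let σ := Fintype.equivFin ι
  let n := Fintype.card ι
  -- the vectors
  let v : ι → ℕ → M := fun i j => φ.symm (DirectSum.lof k[X] ι Q i (Submodule.Quotient.mk (Polynomial.X ^ j)))
  let w : Fin n → ℕ → W := fun i j => of.symm (v (σ.symm i) j)
  let D : Fin n → ℕ := fun i => (r (σ.symm i)).natDegree
  let c : Fin n → ℕ → k := fun i m => (r (σ.symm i)).leadingCoeff⁻¹ * (r (σ.symm i)).coeff m
  -- k-linearity of φ.symm and lof over k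
  have hφc : ∀ (a : k) (y : DirectSum ι Q), φ.symm (a • y) = a • φ.symm y := fun a y => by
    rw [← algebraMap_smul (A := k[X]) a y, map_smul, algebraMap_smul]
  have hlofc : ∀ i (a : k) (q : Q i), DirectSum.lof k[X] ι Q i (a • q) = a • DirectSum.lof k[X] ι Q i q :=
    fun i a q => by rw [← algebraMap_smul (A := k[X]) a q, map_smul, algebraMap_smul]
  -- linear combinations in the summand i transport to combinations of the v i j
  have hcomb : ∀ i (d : ℕ → k) (m : ℕ),
      φ.symm (DirectSum.lof k[X] ι Q i (∑ j ∈ Finset.range m, d j • Submodule.Quotient.mk (Polynomial.X ^ j))) =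
        ∑ j ∈ Finset.range m, d j • v i j := fun i d m => by
    rw [map_sum, map_sum]
    exact Finset.sum_congr rfl (fun j _ => by rw [hlofc, hφc])
  have hXv : ∀ i j, (Polynomial.X : k[X]) • v i j = v i (j + 1) := fun i j => by
    simp only [v]
    rw [← map_smul, ← map_smul, ← Submodule.Quotient.mk_smul, smul_eq_mul, ← pow_succ']
  have hgw : ∀ i j, g (w i j) = w i (j + 1) := fun i j => by
    simp only [w]
    rw [← Module.AEval'.of_symm_X_smul, hXv]
  -- the top relation in coordinates
  have htop : ∀ i : Fin n, of.symm (v (σ.symm i) (D i)) = -∑ m ∈ Finset.range (D i), c i m • w i m := fun i => by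
    simp only [v, D, w, c]
    rw [quot_top _ (hr _), map_neg, map_neg, hcomb, map_neg, map_sum]
    simp only [map_smul]
    rfl
  refine ⟨n, D, c, w, ?_, fun x => ?_, hgw, fun i => ?_, fun hnil i m hm => ?_⟩
  · -- Σ D i = finrank W
    haveI : ∀ i, Module.Finite k (Q i) := fun i => Module.Finite.of_basis (quotBasis (r i) (hr i))
    have h1 : finrank k W = finrank k (DirectSum ι Q) := of.finrank_eq.trans (φ.restrictScalars k).finrank_eq
    rw [h1, (DirectSum.linearEquivFunOnFintype k ι Q).finrank_eq, Module.finrank_pi_fintype,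
      ← Equiv.sum_comp σ.symm (fun i => finrank k (Q i))]
    exact Finset.sum_congr rfl (fun i _ => (finrank_quot _ (hr _)).symm)
  · -- spanning
    set y := φ (of x) with hy
    choose d hd using fun i => quot_span (r i) (hr i) (y i)
    refine ⟨fun i => d (σ.symm i), ?_⟩
    have hx : x = of.symm (φ.symm y) := by simp [hy]
    have hy' : y = ∑ i, DirectSum.lof k[X] ι Q i (y i) := by
      conv_lhs => rw [← DirectSum.sum_univ_of y]
      rfl
    rw [hx, hy', map_sum, map_sum, ← Equiv.sum_comp σ.symm]
    refine Finset.sum_congr rfl (fun i _ => ?_)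
    rw [hd (σ.symm i), hcomb, map_sum]
    refine Finset.sum_congr rfl (fun j _ => ?_)
    rw [map_smul]
  · -- top relation
    rcases Nat.eq_zero_or_pos (D i) with h0 | hpos
    · have hw0 : w i 0 = 0 := by
        have := htop i
        rw [h0, Finset.range_zero, Finset.sum_empty, neg_zero] at this
        exact this
      rw [h0, Nat.zero_sub, hw0, map_zero, Finset.range_zero, Finset.sum_empty, neg_zero]
    · obtain ⟨d', hd'⟩ := Nat.exists_eq_add_of_lt hpos
      have hD : D i = d' + 1 := by omega
      have h := htop i
      rw [hD] at h ⊢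
      rw [Nat.add_sub_cancel, hgw]
      exact h
  · -- nilpotent case
    obtain ⟨N, hN⟩ := hnil
    have hXN : ∀ mm : M, (Polynomial.X ^ N : k[X]) • mm = 0 := fun mm => by
      have := Module.AEval'.X_pow_smul_of g (of.symm mm) N
      rw [LinearEquiv.apply_symm_apply] at this
      rw [this, hN]; simp
    have hdvd : r (σ.symm i) ∣ Polynomial.X ^ N := by
      have h1 := hXv (σ.symm i) 0
      have h2 : (Polynomial.X ^ N : k[X]) • v (σ.symm i) 0 = 0 := hXN _
      simp only [v] at h2
      rw [← map_smul, ← map_smul, ← Submodule.Quotient.mk_smul, smul_eq_mul, pow_zero, mul_one,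
        LinearEquiv.map_eq_zero_iff] at h2
      have h3 := congrArg (fun z => z (σ.symm i)) h2
      simp only [DirectSum.lof_apply, DirectSum.zero_apply] at h3
      rw [Submodule.Quotient.mk_eq_zero, Submodule.mem_span_singleton] at h3
      obtain ⟨q, hq⟩ := h3
      exact ⟨q, by rw [← hq, smul_eq_mul, mul_comm]⟩
    simp only [c]
    rw [coeff_eq_zero_of_dvd_X_pow _ hdvd m hm, mul_zero]

end Cyclic

/-! ## `N` blocks: `a` bijective and `a⁻¹ b` nilpotent -/

section Nilpotent

variable {W W' : Type*} [AddCommGroup W] [Module k W] [AddCommGroup W'] [Module k W']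
  [FiniteDimensional k W]

/-- A Kronecker `δ`-sum: `Σ_{c<D} [c = t] • F c = F t` for `t < D`, and `= 0` for `t ≥ D`. -/
theorem sum_delta_smul (D t : ℕ) (F : ℕ → W') :
    ∑ c ∈ Finset.range D, (if c = t then (1 : k) else 0) • F c = if t < D then F t else 0 := by
  simp only [ite_smul, one_smul, zero_smul, Finset.sum_ite_eq', Finset.mem_range]

/-- **`N`-block decomposition.** If `a : W → W'` is bijective and `g` with `a ∘ g = b` is nilpotent then `(a, b)` has a
block decomposition into `N` blocks (power bases of the cyclic decomposition of `g`). -/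
theorem nilpotent_blockDecomposition (a b : W →ₗ[k] W') (ha : Function.Bijective a) (g : W →ₗ[k] W)
    (hg : ∀ w, a (g w) = b w) (hnil : IsNilpotent g) :
    ∃ (n : ℕ) (m : Fin n → ℕ) (e : Fin n → ℕ → W) (f : Fin n → ℕ → W'),
      IsBlockDecomposition a b (fun i => KBlock.N (m i)) e f := by
  classical
  obtain ⟨n, D, c, w, hcount, hspan, hgw, htop, hc⟩ := cyclic_decomposition g
  have hc0 := hc hnil
  have hwD : ∀ i, 0 < D i → w i (D i) = 0 := fun i hpos => by
    have h := htop i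
    obtain ⟨d', hd'⟩ := Nat.exists_eq_add_of_lt hpos
    have hD : D i = d' + 1 := by omega
    rw [hD, Nat.add_sub_cancel, hgw] at h
    rw [hD, h, neg_eq_zero]
    exact Finset.sum_eq_zero (fun mm hmm => by rw [hc0 i mm (by rw [hD]; exact Finset.mem_range.mp hmm), zero_smul])
  set α := LinearEquiv.ofBijective a ha with hα
  have hαa : ∀ x, α x = a x := fun x => rfl
  refine ⟨n, D, w, fun i j => a (w i j), ⟨?_, ?_, hspan, fun v => ?_, fun i r hr => ?_, fun i r hr => ?_⟩⟩
  · simpa [KBlock.rows] using hcount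
  · rw [← α.finrank_eq]; simpa [KBlock.cols] using hcount
  · obtain ⟨d, hd⟩ := hspan (α.symm v)
    refine ⟨d, ?_⟩
    have h1 : a (α.symm v) = v := by rw [← hαa]; exact α.apply_symm_apply v
    rw [← h1, hd, map_sum]
    simp only [map_sum, map_smul, KBlock.cols]
  · simp only [KBlock.rows] at hr
    simp only [KBlock.cols, KBlock.A, sum_delta_smul, if_pos hr]
  · simp only [KBlock.rows] at hr
    simp only [KBlock.cols, KBlock.B]
    rw [← hg, hgw, sum_delta_smul]
    split_ifs with h
    · rfl
    · rw [show r + 1 = D i by omega, hwD i (by omega), map_zero]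

end Nilpotent

end Summit.MatrixMultiplication.OmegaCensus.SmallFormats.Kronecker
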